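import Summits.HodgeConjecture.HodgeConjecture.Theorems.Ring2WeilCoverageNormClassEq
import Summits.HodgeConjecture.HodgeConjecture.Theorems.Ring2WeilCoverageNormTableC
import HarnessLib

/-!
# Weil-type family coverage — product windows, part S: the FIRST curve-carried member on `W6.2.35 = (3, ℚ(√-2), [35])` (`GL₂(3) × S₃₅`)

research route conditional on HC_CM; not a corollary; Q11.4-sentence-2 already refuted in dim ≥ 3.

Ring 2, WEIL-TYPE FAMILY-COVERAGE CENSUS (`HOME/WEIL-FAMILY-COVERAGE.md` `## b04`, block b04.15 P.S. 5, owner ring2-b04, gen 51); nineteenth part of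
`Ring2WeilCoverageProductWindow` (same conventions as parts L–R).  The window `GL₂(3) × S_n` (`GL₂(3)` = ring2-b02's degree-2 carrier of `ℚ(√-2)`,
`H₁` a reflection, `S_in = ∅`; generic carrier scan `symwin.py gscan` with the sign filter; random realisation with 2·10⁷ tries; engine `bigwin.py`
on the `24·35 = 840`-sheet coset / fibre-product cover; kit j206872): the rigid Belyi datum `(3:3¹¹.2, 2:2¹⁷.1, 8a:8³.4².2.1)` of degree 35
(`S₃₅`; Galois closure of genus ≈ 5.2·10⁴⁰; `Y` of genus 22) has hidden factor `B` a `(3,3)` WEIL-TYPE sixfold with literal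
`det H = -1/11340 = -1/(2²·3⁴·5·7)`, `T = {5, 7}`, class `[35]` = `W6.2.35` — pub-hsemireg R4 (`ℚ(√-2)`, `a = 35`), the FIRST curve-carried
member of that row (any seat); THEOREM S7 predicts `[35]^{r₁}`, `r₁ = 1` ✓.

No `def`, no named fact, no `sorry`; nothing here is a statement about Hodge classes; `HC_CM` is used nowhere.
References: [cite: vanGeemen1994HodgeAV, (5.4.1), Lemma 5.2]; [cite: Serre1973, Ch. III §1].
-/

set_option linter.dupNamespace false

open Literature.AlgebraicGeometry.Motives
open Literature.AlgebraicGeometry.VanGeemen1994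
open Summit.HodgeConjecture.HodgeConjecture.Ring2.Hypotheses

namespace Summit.HodgeConjecture.HodgeConjecture.Ring2.WeilCoverage

/-- FIBRE-PRODUCT datum `GL23xS35` `(0; 3:3^11.2,2:2^17.1,8a:8^3.4^2.2.1)` (cycle types in `S35`; Hurwitz dimension 0; realised by explicit permutations with product one, generation: 2-transitive + Jordan (a 2-cycle as the 3-th power of a branch cycle, 2 <= n-3) => monodromy >= A_35): `Y = D ×_{ℙ¹} X` (genus 22; `D` the `GL23`-quotient datum = the CM elliptic curve, `X` the degree-35 cover, genus 0), computed on its 840 sheets (engine `bigwin.py`, exact); the HIDDEN FACTOR `B` = the `λ`-part of the Prym `P(Y/D)` — an abelian SIXFOLD with `(3,3)` `ℚ(√-2)`-action, WEIL TYPE — has literal `det H|_B = -1/11340`, `a = 1/11340`, `T(a) = [5, 7]`: row `W6.2.35` (NON-split); `r₁ = dim_K H¹(D)_λ = 1`, `r_H = 7`. THEOREM S8 (Prym form of the product-window law, census b04.15 (A): `[a_B] = [n]^{r₁}`, no 2-transitivity needed) predicts `T(a_B) = [5, 7]` from `r₁ = 1`, `n = 35` — CONFIRMED.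
research route conditional on HC_CM; not a corollary; Q11.4-sentence-2 already refuted in dim ≥ 3. [cite: vanGeemen1994HodgeAV, (5.4.1)] -/
theorem fibre2_GL23S35_n35_bc938d_mk_detH_ne_split :
    (QuotientGroup.mk (Units.mk0 (((-1 : ℚ) / 11340)) (by norm_num)) : weilNormResidueGroup 2) ≠
      splitDiscriminantClass 3 2 := by
  have e : Units.mk0 (((-1 : ℚ) / 11340)) (by norm_num) = -(Units.mk0 ((1 : ℚ) / 11340) (by norm_num)) := Units.ext (by norm_num)
  rw [Ne, e, mk_neg_eq_splitDiscriminantClass_iff_of_odd (n := 3) (by decide)]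
  have h := mul_not_mem_normUnitsSubgroup (mem_normUnitsSubgroup_of_sq_add_mul_sq (d := 2) (a := ((1 : ℚ) / 396900)) (by norm_num) ((1 : ℚ) / 630) (0 : ℚ) (by norm_num))
    Summit.HodgeConjecture.HodgeConjecture.Ring2.WeilCoverage.SqrtNeg2.not_mem_35
  rw [mk0_mul_mk0] at h
  norm_num at h
  exact h

/-- The same datum, CELL IDENTIFICATION: `[det H|_B] = [-35]` in `ℚˣ/Nm(ℚ(√-2)ˣ)` — the census ROW KEY of `W6.2.35` (`a·35 = ((1 : ℚ) / 324) = (((1 : ℚ) / 18))² + 2·((0 : ℚ))²`).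
research route conditional on HC_CM; not a corollary; Q11.4-sentence-2 already refuted in dim ≥ 3. [cite: vanGeemen1994HodgeAV, Lemma 5.2 (3)] -/
theorem fibre2_GL23S35_n35_bc938d_mk_detH_eq_key :
    (QuotientGroup.mk (Units.mk0 (-(((1 : ℚ) / 11340))) (neg_ne_zero.2 (by norm_num))) : weilNormResidueGroup 2) =
      QuotientGroup.mk (Units.mk0 (-(35 : ℚ)) (neg_ne_zero.2 (by norm_num))) :=
  mk_neg_eq_mk_neg_of_mul_mem (by norm_num) (by norm_num)
    (mem_normUnitsSubgroup_of_sq_add_mul_sq _ ((1 : ℚ) / 18) (0 : ℚ) (by norm_num))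

end Summit.HodgeConjecture.HodgeConjecture.Ring2.WeilCoverage
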